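import Summits.QuantumAdvantage.QuantumAdvantage.Theorems.CubicForrelationNearExactIsExactSixteenSplitA
import Summits.QuantumAdvantage.QuantumAdvantage.Theorems.CubicForrelationNearExactIsExactSixteenSplitB
import Summits.QuantumAdvantage.QuantumAdvantage.Theorems.CubicForrelationNearExactIsExactSixteenSplitC
import Summits.QuantumAdvantage.QuantumAdvantage.Theorems.CubicForrelationNearExactIsExactSixteenThirtyOneThirtySeconds
import Summits.QuantumAdvantage.QuantumAdvantage.Theorems.CubicForrelationNearExactIsExactFourteenBoundary

/-!
# Crux `CubicForrelation.NearExactIsExact` (stmt-QuantumAdvantage-14043) — n = 16: the boundary value `31/32` is NOT attained;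
  `Φ ≥ 31/32 ⇒ Φ = 1` for cubic pairs on 16 bits, so `θ₁₆ ∈ [15/16, 31/32)`

Certificate seat `b2b-cforr-cert` (gen 6).  HONEST FRAMING: a DECIDABLE VERDICT about the finite slice `n = 16` of the crux, obtained by a
TWO-SIDED (partner-using) argument above the one-sided ladder — NOT summit progress (the crux needs one `θ < 1` for all `n`).

The tree had `θ₁₆ ∈ [15/16, 31/32]` (`theta_sixteen_bounds_31_32`: isolation above `31/32` by the one-sided capacity argument of gen 3,
`15/16` attained).  Whether `Φ = 31/32` occurs on 16 bits needs the partner `f`.  ASSEMBLY (`sb16_isolation_sixteen_ge`): write `W_g = 64u` (Ax).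
* all `u` odd (type O): `Φ < 31/32` (`st_typeO_sixteen_lt`, gen 4);
* all `u` even (level `≥ 7`): `Φ = 1` (`sl_levelSeven_ge`, this generation; level `≥ 8` inside by `se_levelEight_ge`, gen 4);
* mixed parity (split): the two-sided budget forces one of three rigid configurations (`sb_split_trichotomy`), each empty
  (`sa_splitA_false`, `sbb_splitB_false`, `sc_splitC_false` — flats carrying sign patterns of rank `≤ 2`, whose few large frequencies cannot
  supply the pairing `Σ_y (−1)^g τ̂(y) = 2²¹`).
Hence `isolation_sixteen_closed` (at the literal type `Fin 16`), `theta_sixteen_lt` (some `θ < 31/32` isolates exactness on 16 bits), and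
`theta_sixteen_halfopen`: the least isolation constant satisfies `15/16 ≤ θ₁₆ < 31/32`.  The window `(15/16, 31/32)` remains open.

References: as in the imported files (Ax/McEliece, MacWilliams–Sloane Ch. 13–15, O'Donnell 2014 §3.3, Aaronson–Ambainis 2018 §1.1.1).
Everything below is proved from Mathlib and the tree; axioms are the standard three; no `decide` beyond small Boolean enumerations upstream.
-/

set_option linter.dupNamespace false -- D-0017: single-problem summit ⇒ `QuantumAdvantage.QuantumAdvantage` by design

noncomputable section

namespace Summit.QuantumAdvantage.QuantumAdvantage.Theorems.CubicForrelation.NearExactIsExact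

open Finset
open Literature.Computability.QuantumComplexity
open Literature.Computability.QuantumComplexity.DerivativeWalsh (W)

/-- **`Φ ≥ 31/32 ⇒ Φ = 1` for cubic pairs on `8 + 8` bits** (the assembly described in the header). [this work] -/
theorem sb16_isolation_sixteen_ge (f g : (Fin (8 + 8) → Bool) → Bool) (hf : IsDegLeFun 3 f) (hg : IsDegLeFun 3 g)
    (hΦ : (31 / 32 : ℝ) ≤ forrelation f g) : forrelation f g = 1 := by
  obtain ⟨u, hu⟩ := tw_base g hg 6 (by norm_num)
  by_cases hO : ∀ x, Odd (u x)
  · -- type O: `Φ < 31/32`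
    exact absurd hΦ (not_le.2 (st_typeO_sixteen_lt f g hf hg u hu hO))
  · by_cases hE : ∀ x, ¬ Odd (u x)
    · -- level ≥ 7
      have hw : ∀ x, W (fun y => signOf (g y)) x = (2 : ℝ) ^ 7 * (((u x / 2 : ℤ)) : ℝ) := by
        intro x
        rw [hu x]
        obtain ⟨k, hk⟩ := Int.not_odd_iff_even.1 (hE x)
        rw [hk, show k + k = 2 * k by ring, Int.mul_ediv_cancel_left k (by norm_num : (2 : ℤ) ≠ 0)]
        push_cast
        ring
      exact sl_levelSeven_ge f g hf hg _ hw hΦ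
    · -- split
      push Not at hO hE
      obtain ⟨hΦeq, hpt, hcases⟩ := sb_split_trichotomy f g u hg hu hE hO hΦ
      exfalso
      rcases hcases with ⟨hA, hB, hC⟩ | ⟨hA, hB, hC⟩ | ⟨hA, hB, hC⟩
      · exact sa_splitA_false f g hf hg u hu hE hO hΦeq hpt hA hB hC
      · exact sbb_splitB_false f g hf hg u hu hE hO hΦeq hpt hA hB hC
      · exact sc_splitC_false f g hf hg u hu hE hO hΦeq hpt hA hB hC

/-- **The boundary value `31/32` is not attained on 16 bits: `Φ(f,g) ≥ 31/32 ⇒ Φ(f,g) = 1` for all cubic `f, g : 𝔽₂¹⁶ → 𝔽₂`** (at the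
literal type `Fin 16`).  Improves `isolation_sixteen_31_32` (`>`) to `≥`; the improvement is two-sided (it uses the partner `f`).
Finite-slice verdict; NOT summit progress. [this work] -/
theorem isolation_sixteen_closed : ∀ f g : (Fin 16 → Bool) → Bool, IsDegLeFun 3 f → IsDegLeFun 3 g →
    (31 / 32 : ℝ) ≤ forrelation f g → forrelation f g = 1 :=
  fun f g hf hg h => sb16_isolation_sixteen_ge f g hf hg h

/-- **`θ₁₆ < 31/32`: some constant strictly below `31/32` already isolates exactness for cubic pairs on 16 bits** — the largest forrelation
value `≠ 1` of a cubic pair on 16 bits, which is `< 31/32` by `isolation_sixteen_closed`.  Finite-slice verdict; NOT summit progress.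
[this work] -/
theorem theta_sixteen_lt : ∃ θ : ℝ, θ < 31 / 32 ∧ ∀ f g : (Fin 16 → Bool) → Bool, IsDegLeFun 3 f → IsDegLeFun 3 g →
    θ < forrelation f g → forrelation f g = 1 :=
  fb_theta_lt_of_closed (n := 16) (31 / 32) isolation_sixteen_closed

/-- **`θ₁₆ ∈ [15/16, 31/32)`** — the `n = 16` row of the ladder with a HALF-OPEN upper end: the least isolation constant `θ₁₆` for cubic pairs
on 16 bits exists, is at least `15/16` (attained by the biquadratic Maiorana–McFarland pair, `theta_sixteen_bounds_31_32`) and is STRICTLY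
below the one-sided constant `31/32` (`theta_sixteen_lt`).  The window `(15/16, 31/32)` remains open.  Finite-slice verdict; NOT summit
progress. [this work] -/
theorem theta_sixteen_halfopen : ∃ θ₀ : ℝ, 15 / 16 ≤ θ₀ ∧ θ₀ < 31 / 32 ∧
    IsLeast {θ : ℝ | ∀ f g : (Fin 16 → Bool) → Bool, IsDegLeFun 3 f → IsDegLeFun 3 g →
      θ < forrelation f g → forrelation f g = 1} θ₀ := by
  obtain ⟨θ₀, hθ₀⟩ := theta_exists 16
  obtain ⟨θ', hθ', hiso⟩ := theta_sixteen_lt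
  exact ⟨θ₀, theta_sixteen_bounds_31_32.2 θ₀ hθ₀.1, lt_of_le_of_lt (hθ₀.2 hiso) hθ', hθ₀⟩

/-- **No cubic pair on 16 bits has `31/32 ≤ Φ < 1`** (the closed boundary window is empty). [this work] -/
theorem no_boundary_window_sixteen : ¬ ∃ f g : (Fin 16 → Bool) → Bool, IsDegLeFun 3 f ∧ IsDegLeFun 3 g ∧
    (31 / 32 : ℝ) ≤ forrelation f g ∧ forrelation f g < 1 := by
  rintro ⟨f, g, hf, hg, hge, hlt⟩
  exact absurd (isolation_sixteen_closed f g hf hg hge) (ne_of_lt hlt)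

end Summit.QuantumAdvantage.QuantumAdvantage.Theorems.CubicForrelation.NearExactIsExact

end
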